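import Summits.CriticalPhenomena.PercolationContinuityZ3.Theorems.PercNearOneGluingNoHeavyLowerTailCILTwoGateTools
import HarnessLib

/-!
# `NoHeavyLowerTail` (stmt-CriticalPhenomena-4575) — set-champion stability from PER-GATE-CLASS reference witnesses

Support file (prover `prim-gen-induct`, blob-quotient / cumulative-isolation line, gen 3; `--supports
stmt-CriticalPhenomena-4575`).  No definitions, no named facts, no sorries.

Notation as in `…CILSetStarTools` / `…CILTwoGateTools`: `μ = prodBernoulli w`, relays `A`, level `j`, observer set `S`
(disjoint from `A`), `ξ(ω) = ω ∩ {e | ∀ v ∈ S, v ∉ e}` ("`K = H − S`"), `~'` reachability in `ξ`, gates `Γ(ω)`, gate classes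
`{Γ = Y}` with weights `q(Y) = μ{Γ = Y}`, and for a class `Y` and a relay `x` the `K`-quantities (all read off `ξ`)
`ℓ_Y(x) = μ(x ≁' Y, 1 ≤ |π'(Y)| ≤ j)`, `r_Y(x) = μ(x ≁' Y, |π'(x)| ≤ j)`, `b_Y(x) = μ(x ~' Y, |π'(Y)| ≤ j)`, so that
`CS_K(Y, x) : ℓ_Y(x) ≤ r_Y(x)` and `J^Y(x) := r_Y(x) + b_Y(x)` is the lightness of `x` in `K` with `Y` glued.

* `SetStar.setCS_of_classWitnesses` — **the averaged witness shift.**  If the gate set lies a.s. in a finite family `𝒴`, every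
  nonempty class `Y ∈ 𝒴` comes with a reference relay `x_Y` satisfying `CS_K(Y, x_Y)`, and
  `q(∅)·I_K(c) + Σ_{∅ ≠ Y ∈ 𝒴} q(Y)·(J^Y(c) − J^Y(x_Y)) ≥ 0`, then `CS_w(S, c)`.

This is the general form of the mechanism behind `TwoGate.setCS_of_twoGate` (there `x_Y ≡ champ(K)`): by the flat expansion
(`SetStar.setL_eq_sum/setR_eq_sum`) `μ(RS) − μ(LS) = Σ_Y q(Y)·Δ_K(Y, c)`, and the witness-shift identity
`Δ_K(Y, c) − Δ_K(Y, x) = J^Y(c) − J^Y(x)` (`TwoGate.setL_add_near`) bounds each class term below by the reference.  It is the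
Lean socket for per-class certificates of the induction STEP beyond two gates (crux notes BLOBQUOTIENT.md §21: with references
`champ(K)` or a relay no `K`-lighter than a member of the class, the averaged inequality has no counterexample for three gates).
-/

noncomputable section

namespace Summit.CriticalPhenomena.PercolationContinuityZ3.Theorems

open MeasureTheory Set Literature.Probability.LatticeModels Literature.Probability.Percolation
open scoped Classical BigOperators

variable {n : ℕ}

namespace CutObserver

namespace SetStar

open TwoGate in
/-- **Set-champion stability from per-gate-class reference witnesses (averaged witness shift).**  Let `S` be disjoint
from `A`, `c ∈ A`, `𝒴` a finite family of vertex sets carrying the gate set `Γ` almost surely, and `x : 𝒴 → A` reference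
relays with `CS_K(Y, x_Y)` for every nonempty `Y ∈ 𝒴`.  If
`Σ_{Y ∈ 𝒴} q(Y)·g(Y) ≥ 0`, where `g(∅) = I_K(c)` and `g(Y) = J^Y(c) − J^Y(x_Y)` otherwise (all quantities read off
`ξ(ω) = ω ∩ {e | ∀ v ∈ S, v ∉ e}`), then `CS_w(S, c)`: `μ(c ↮ S, 1 ≤ |π(S)| ≤ j) ≤ μ(c ↮ S, |π(c)| ≤ j)`. [folklore] -/
theorem setCS_of_classWitnesses (w : Sym2 (Fin n) → unitInterval) (A S : Finset (Fin n)) (c : Fin n) (j : ℕ)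
    (hSA : Disjoint S A) (hcA : c ∈ A) (𝒴 : Finset (Finset (Fin n)))
    (h𝒴 : (prodBernoulli w).real
      {ω : BondConfig (Fin n) | (Finset.univ.filter fun u => u ∉ S ∧ ∃ v ∈ S, s(u, v) ∈ ω) ∉ 𝒴} = 0)
    (x : Finset (Fin n) → Fin n) (hxA : ∀ Y ∈ 𝒴, x Y ∈ A)
    (hW : ∀ Y ∈ 𝒴, Y.Nonempty →
      (prodBernoulli w).real {ω : BondConfig (Fin n) |
          (∀ u ∈ Y, ¬ (openGraph (ω ∩ {e | ∀ v ∈ S, v ∉ e})).Reachable (x Y) u) ∧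
            1 ≤ (A.filter fun b => ∃ u ∈ Y, (openGraph (ω ∩ {e | ∀ v ∈ S, v ∉ e})).Reachable u b).card ∧
            (A.filter fun b => ∃ u ∈ Y, (openGraph (ω ∩ {e | ∀ v ∈ S, v ∉ e})).Reachable u b).card ≤ j} ≤
        (prodBernoulli w).real {ω : BondConfig (Fin n) |
          (∀ u ∈ Y, ¬ (openGraph (ω ∩ {e | ∀ v ∈ S, v ∉ e})).Reachable (x Y) u) ∧
            (A.filter fun b => (openGraph (ω ∩ {e | ∀ v ∈ S, v ∉ e})).Reachable (x Y) b).card ≤ j})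
    (havg : 0 ≤ ∑ Y ∈ 𝒴,
      (prodBernoulli w).real
          {ω : BondConfig (Fin n) | (Finset.univ.filter fun u => u ∉ S ∧ ∃ v ∈ S, s(u, v) ∈ ω) = Y} *
        (if Y = ∅ then
          (prodBernoulli w).real {ω : BondConfig (Fin n) |
            (A.filter fun b => (openGraph (ω ∩ {e | ∀ v ∈ S, v ∉ e})).Reachable c b).card ≤ j}
         else
          (((prodBernoulli w).real {ω : BondConfig (Fin n) |
              (∀ u ∈ Y, ¬ (openGraph (ω ∩ {e | ∀ v ∈ S, v ∉ e})).Reachable c u) ∧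
                (A.filter fun b => (openGraph (ω ∩ {e | ∀ v ∈ S, v ∉ e})).Reachable c b).card ≤ j} +
            (prodBernoulli w).real {ω : BondConfig (Fin n) |
              (∃ u ∈ Y, (openGraph (ω ∩ {e | ∀ v ∈ S, v ∉ e})).Reachable c u) ∧
                (A.filter fun b => ∃ u ∈ Y, (openGraph (ω ∩ {e | ∀ v ∈ S, v ∉ e})).Reachable u b).card ≤ j}) -
          ((prodBernoulli w).real {ω : BondConfig (Fin n) |
              (∀ u ∈ Y, ¬ (openGraph (ω ∩ {e | ∀ v ∈ S, v ∉ e})).Reachable (x Y) u) ∧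
                (A.filter fun b => (openGraph (ω ∩ {e | ∀ v ∈ S, v ∉ e})).Reachable (x Y) b).card ≤ j} +
            (prodBernoulli w).real {ω : BondConfig (Fin n) |
              (∃ u ∈ Y, (openGraph (ω ∩ {e | ∀ v ∈ S, v ∉ e})).Reachable (x Y) u) ∧
                (A.filter fun b => ∃ u ∈ Y, (openGraph (ω ∩ {e | ∀ v ∈ S, v ∉ e})).Reachable u b).card ≤ j}))))
    : (prodBernoulli w).real {ω : BondConfig (Fin n) | (∀ y ∈ S, ω ∉ openConn c y) ∧
        1 ≤ (A.filter fun b => ∃ y ∈ S, ω ∈ openConn y b).card ∧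
        (A.filter fun b => ∃ y ∈ S, ω ∈ openConn y b).card ≤ j} ≤
      (prodBernoulli w).real {ω : BondConfig (Fin n) | (∀ y ∈ S, ω ∉ openConn c y) ∧
        (A.filter fun b => ω ∈ openConn c b).card ≤ j} := by
  haveI : IsProbabilityMeasure (prodBernoulli w) := inferInstance
  set μ := prodBernoulli w with hμ
  have hcS : c ∉ S := fun h => Finset.disjoint_left.1 hSA h hcA
  set LS := {ω : BondConfig (Fin n) | (∀ y ∈ S, ω ∉ openConn c y) ∧
    1 ≤ (A.filter fun b => ∃ y ∈ S, ω ∈ openConn y b).card ∧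
    (A.filter fun b => ∃ y ∈ S, ω ∈ openConn y b).card ≤ j} with hLS
  set RS := {ω : BondConfig (Fin n) | (∀ y ∈ S, ω ∉ openConn c y) ∧
    (A.filter fun b => ω ∈ openConn c b).card ≤ j} with hRS
  set q : Finset (Fin n) → ℝ := fun Y =>
    μ.real {ω : BondConfig (Fin n) | (Finset.univ.filter fun u => u ∉ S ∧ ∃ v ∈ S, s(u, v) ∈ ω) = Y} with hq
  set ℓ : Finset (Fin n) → Fin n → ℝ := fun Y t => μ.real {ω : BondConfig (Fin n) |
    (∀ u ∈ Y, ¬ (openGraph (ω ∩ {e | ∀ v ∈ S, v ∉ e})).Reachable t u) ∧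
      1 ≤ (A.filter fun b => ∃ u ∈ Y, (openGraph (ω ∩ {e | ∀ v ∈ S, v ∉ e})).Reachable u b).card ∧
      (A.filter fun b => ∃ u ∈ Y, (openGraph (ω ∩ {e | ∀ v ∈ S, v ∉ e})).Reachable u b).card ≤ j} with hℓ
  set r : Finset (Fin n) → Fin n → ℝ := fun Y t => μ.real {ω : BondConfig (Fin n) |
    (∀ u ∈ Y, ¬ (openGraph (ω ∩ {e | ∀ v ∈ S, v ∉ e})).Reachable t u) ∧
      (A.filter fun b => (openGraph (ω ∩ {e | ∀ v ∈ S, v ∉ e})).Reachable t b).card ≤ j} with hr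
  set bb : Finset (Fin n) → Fin n → ℝ := fun Y t => μ.real {ω : BondConfig (Fin n) |
    (∃ u ∈ Y, (openGraph (ω ∩ {e | ∀ v ∈ S, v ∉ e})).Reachable t u) ∧
      (A.filter fun b => ∃ u ∈ Y, (openGraph (ω ∩ {e | ∀ v ∈ S, v ∉ e})).Reachable u b).card ≤ j} with hbb
  set bad : Finset (Fin n) → ℝ := fun Y => μ.real {ω : BondConfig (Fin n) |
    1 ≤ (A.filter fun b => ∃ u ∈ Y, (openGraph (ω ∩ {e | ∀ v ∈ S, v ∉ e})).Reachable u b).card ∧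
      (A.filter fun b => ∃ u ∈ Y, (openGraph (ω ∩ {e | ∀ v ∈ S, v ∉ e})).Reachable u b).card ≤ j} with hbad
  set IK : Fin n → ℝ := fun t => μ.real {ω : BondConfig (Fin n) |
    (A.filter fun b => (openGraph (ω ∩ {e | ∀ v ∈ S, v ∉ e})).Reachable t b).card ≤ j} with hIK
  -- flat expansions
  have hL : μ.real LS = ∑ Y ∈ 𝒴, q Y * ℓ Y c := setL_eq_sum w A S c j hSA hcS 𝒴 h𝒴
  have hR : μ.real RS = ∑ Y ∈ 𝒴, q Y * r Y c := setR_eq_sum w A S c j hcS 𝒴 h𝒴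
  -- the per-class gain
  set g : Finset (Fin n) → ℝ := fun Y =>
    if Y = ∅ then IK c else (r Y c + bb Y c) - (r Y (x Y) + bb Y (x Y)) with hg
  have havg' : 0 ≤ ∑ Y ∈ 𝒴, q Y * g Y := havg
  -- bookkeeping
  have hshift : ∀ Y, ∀ t ∈ A, ℓ Y t + bb Y t = bad Y := fun Y t ht =>
    setL_add_near w A Y {e | ∀ v ∈ S, v ∉ e} ht j
  have hℓ0 : ∀ t, ℓ ∅ t = 0 := fun t => setL_empty w A {e | ∀ v ∈ S, v ∉ e} t j
  have hr0 : ∀ t, r ∅ t = IK t := fun t => setR_empty w A {e | ∀ v ∈ S, v ∉ e} t j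
  -- each class term dominates the gain
  have hterm : ∀ Y ∈ 𝒴, g Y ≤ r Y c - ℓ Y c := by
    intro Y hY
    by_cases hY0 : Y = ∅
    · rw [hY0, hℓ0, hr0]
      simp only [hg, if_true]
      linarith
    · have hne : Y.Nonempty := Finset.nonempty_iff_ne_empty.2 hY0
      have e1 := hshift Y c hcA
      have e2 := hshift Y (x Y) (hxA Y hY)
      have hWY : ℓ Y (x Y) ≤ r Y (x Y) := hW Y hY hne
      simp only [hg, hY0, if_false]
      linarith
  have hq0 : ∀ Y ∈ 𝒴, 0 ≤ q Y := fun Y _ => measureReal_nonneg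
  have hsum : ∑ Y ∈ 𝒴, q Y * ℓ Y c ≤ ∑ Y ∈ 𝒴, q Y * r Y c := by
    have h1 : ∑ Y ∈ 𝒴, q Y * g Y ≤ ∑ Y ∈ 𝒴, q Y * (r Y c - ℓ Y c) :=
      Finset.sum_le_sum fun Y hY => mul_le_mul_of_nonneg_left (hterm Y hY) (hq0 Y hY)
    have h2 : ∑ Y ∈ 𝒴, q Y * (r Y c - ℓ Y c) = ∑ Y ∈ 𝒴, q Y * r Y c - ∑ Y ∈ 𝒴, q Y * ℓ Y c := by
      rw [← Finset.sum_sub_distrib]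
      exact Finset.sum_congr rfl fun Y _ => by ring
    linarith
  exact (hL.trans_le hsum).trans_eq hR.symm

end SetStar

end CutObserver

end Summit.CriticalPhenomena.PercolationContinuityZ3.Theorems

end
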